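import Summits.QuantumFields.BalabanUV.T4Continuum.Support.ShellMeasurePlaquetteCubicSplit

/-!
# `T4Continuum.ShellMeasurePlaquetteCubicLocal` — the one-grid (39)∕(40) split made JUNCTION-READY: TRACE-FREE main term,
# ONE regularity number, LOCALITY and ANALYTICITY of `V₀′`, and the cubic binder in row S65 f2b's literal `hcub` shape
# (file 6 of «S65 f4»; answers the row holder's requests, journal l.15529, and folds in leaf-01-g6's remark l.15887)

Cell `pub-balaban`, sub-cell `t4`, spine estimate NE7c (node U5b), NE7c ROUND-2 crew `t4-ne7c-formalise-*`, unit
`b2b-balaban-t4-ne7c-formalise-leaf-03` gen 4; owner table `t4/b2b-balaban-t4-ne7c-p1/LEAVES-NE7c-P1.md` v2.9 row **S65 f4**.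
ADDITIVE: imports file 5 `ShellMeasurePlaquetteCubicSplit` ONLY; modifies nothing; [folklore]; 0 `def … : Prop`, 0 sorry,
0 citation tags.

HONEST FRAMING.  Finite four-torus programme, rung (B)+1 only — NOT infinite volume, NOT a mass gap, NOT the Clay
problem, NOT summit progress.  NE7c (`T4IndicatorShell.ShellWeightBound`) is NOT PRINTED and NOT PROVED; «NE7c ⇐ the
named binders».  Nothing of [Balaban1985Variational] is asserted ((39)∕(40) p. 284 are LOCATORS for the SHAPE, at ONE
GRID).  HONEST DEPENDENCY (cell, verbatim): continuum YM on T⁴ ⇐ BetaPertH ∧ nine spine estimates (0/9 proved); BetaPertH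
⇐ (D1) ∧ (D4) ∧ CAP+tail; G-an2-4 gates asym, D1 and NE2/3/4.

WHAT IS PROVED (on top of file 5's `ord₃ (plaqFunSym τ U bd) A = mainTerm + V0rem`, `‖V0rem‖ ≤ ‖τ‖(S³ε₀∕6 + (5∕96)S⁴)`):
* §1 THE REVERSAL IDENTITY IS TRACE-FREE (credit: leaf-01-g6, journal l.15887): in the free algebra
  `polyC [y₁,y₂,y₃,y₄] + polyC [−y₄,−y₃,−y₂,−y₁] = ½·(Y·K + K·Y)` (`Y = Σyᵢ`, `K = Σ_{i<j}[yᵢ,yⱼ]`) — so the split needs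
  NO trace property: `mainTermSym := −¼·τ(Y·K + K·Y)`, `V0remSym := ord₃ (plaqFunSym) − mainTermSym`, and
  **`norm_V0remSym_le`** ∕ **`norm_V0remSym_le_of_bonds`** hold for EVERY `τ : 𝔸 →L[ℂ] ℂ` (S62 f2's arbitrary «trace»);
  under the trace property `mainTermSym = mainTerm` and `V0remSym = V0rem` (`mainTermSym_eq_mainTerm`).
* §2 ONE REGULARITY NUMBER: `‖U₀(∂p)⁻¹ − 1‖ ≤ ‖U₀(∂p) − 1‖` for a unit-bounded background, so only `‖U₀(∂p) − 1‖ ≤ ε₀` is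
  displayed from here on.
* §3 LOCALITY (row S65 f2b's `hloc` shape): `V0remSym τ U bd (A + Pi.single b X) = V0remSym τ U bd A` for `b ∉ bonds bd`
  (everything is a function of the four twisted variables and of `U_A(∂p)`, which read `A` on `∂p` only).
* §4 ANALYTICITY (row S65 f2a's `ha`): `analyticAt_ord₃` (generic: `V` analytic at `A` ⟹ `ord₃ V` analytic at `A`, the
  jet being a continuous polynomial), `analyticAt_tv`, `analyticAt_mainTermSym`, **`analyticAt_V0remSym`** — everywhere.
* §5 THE CUBIC BINDER IN `hcub` SHAPE at `W p = 1`: for `‖U₀(∂p) − 1‖ ≤ ε₀`, `4s₀ ≤ 1`: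
  `∀ A σ, 0 ≤ σ → σ < s₀ → (∀ b′ ∈ bonds bd, ‖A b′‖ ≤ σ) → ‖V0remSym τ U bd A‖ ≤ ‖τ‖(32∕3·ε₀ + 40∕3·s₀)·σ³` —
  LITERALLY the `hcub` binder of `ShellMeasureGradientTailLevels.weighted_locGrad_le` ∕
  `ShellMeasureMultiGridNorms.prop4Hyp_locGrad_levels` at `W p = 1` with `κ = ‖τ‖(32∕3·ε₀ + 40∕3·s₀)`, together with §3 = their
  `hloc` and §4 = their `ha`∕`hd`.  The η∕Lʲη-scaled junction at the live levels (row S65 f5, J1) is NOT here.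
-/

noncomputable section

open scoped BigOperators
open NormedSpace Metric Set

namespace Summit.QuantumFields.BalabanUV.T4Continuum.ShellMeasurePlaquetteCubicLocal

open Literature.MathematicalPhysics.QuantumFieldTheory.Balaban1983to89
open B7Eq78Linearization (conjR conjR_apply)
open ShellMeasureWilsonGradientTail (letter plaqWord bonds)
open ShellMeasureCubicTaylor (expRem4 expRem4_le T3 polyL polyQ polyC polyL_cons polyL_nil polyQ_cons polyQ_nil polyC_cons
  polyC_nil t3_expProd_of_le)
open ShellMeasureCubicWord (curl4 comm4)
open ShellMeasureLocalGradientTailJet (ord₃ jet₂)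
open ShellMeasurePlaquetteTwist (twistVar twists plaqFunSym analyticAt_plaqFunSym sum_norm_reverse_neg)
open ShellMeasurePlaquetteCubicSlice (tw twR amp amp_nonneg amp_le_four_mul coef a₁ a₂ a₃ cubicPoly norm_slice_sub_cubicPoly_le
  ord₃_plaqFunSym_eq)
open ShellMeasurePlaquetteCubicSplit (pre tv tw_eq twR_eq mainTerm V0rem)

variable {Λ : Type*} {𝔸 : Type*} [NormedRing 𝔸] [NormedAlgebra ℂ 𝔸] [CompleteSpace 𝔸]

/-! ## §1 The reversal identity in the free algebra; the trace-free main term -/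

omit [CompleteSpace 𝔸] in
/-- **THE REVERSAL IDENTITY, TRACE-FREE** (leaf-01-g6's remark): the cubic part of `e^{y₁}e^{y₂}e^{y₃}e^{y₄}` plus that of
`e^{−y₄}e^{−y₃}e^{−y₂}e^{−y₁}` is `½(Y·K + K·Y)` in the algebra itself (the `y³` and `y²y` words cancel; no trace needed).
[folklore] -/
theorem polyC_four_add_rev_eq (y₁ y₂ y₃ y₄ : 𝔸) :
    polyC [y₁, y₂, y₃, y₄] + polyC [-y₄, -y₃, -y₂, -y₁] =
      (2 : ℂ)⁻¹ • (curl4 y₁ y₂ y₃ y₄ * comm4 y₁ y₂ y₃ y₄ + comm4 y₁ y₂ y₃ y₄ * curl4 y₁ y₂ y₃ y₄) := by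
  simp only [polyC_cons, polyC_nil, polyQ_cons, polyQ_nil, polyL_cons, polyL_nil, curl4, comm4, mul_add, add_mul, mul_sub,
    sub_mul, smul_add, smul_sub, smul_mul_assoc, mul_smul_comm, mul_assoc, neg_mul, mul_neg, smul_neg, neg_neg, add_zero,
    mul_zero]
  module

section Defs

variable [Fintype Λ]

/-- THE TRACE-FREE MAIN TERM `−¼·τ(Y·K + K·Y)` (equal to file 5's `mainTerm = −½·τ(Y·K)` when `τ` has the trace property).
[folklore] -/
def mainTermSym (τ : 𝔸 →L[ℂ] ℂ) (U : Λ → 𝔸ˣ) (bd : Fin 4 → Λ × Bool) (A : Λ → 𝔸) : ℂ :=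
  -((4 : ℂ)⁻¹ * τ (curl4 (tv U bd A 0) (tv U bd A 1) (tv U bd A 2) (tv U bd A 3)
      * comm4 (tv U bd A 0) (tv U bd A 1) (tv U bd A 2) (tv U bd A 3)
    + comm4 (tv U bd A 0) (tv U bd A 1) (tv U bd A 2) (tv U bd A 3)
      * curl4 (tv U bd A 0) (tv U bd A 1) (tv U bd A 2) (tv U bd A 3)))

/-- THE TRACE-FREE REMAINDER `V₀′ := ord₃ (plaqFunSym) − mainTermSym`. [folklore] -/
def V0remSym (τ : 𝔸 →L[ℂ] ℂ) (U : Λ → 𝔸ˣ) (bd : Fin 4 → Λ × Bool) (A : Λ → 𝔸) : ℂ :=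
  ord₃ (plaqFunSym τ U bd) A - mainTermSym τ U bd A

/-- (39), trace-free: `ord₃ (plaqFunSym τ U bd) A = mainTermSym + V0remSym` (by definition). [folklore] -/
theorem ord₃_plaqFunSym_split_sym (τ : 𝔸 →L[ℂ] ℂ) (U : Λ → 𝔸ˣ) (bd : Fin 4 → Λ × Bool) (A : Λ → 𝔸) :
    ord₃ (plaqFunSym τ U bd) A = mainTermSym τ U bd A + V0remSym τ U bd A := by
  simp [V0remSym]

omit [Fintype Λ] in
/-- THE CUBIC COEFFICIENT SPLITS, for EVERY `τ`: `a₃ = mainTermSym − ½(τ(C·(U₀(∂p) − 1)) + τ((U₀(∂p)⁻¹ − 1)·C̄))`. [folklore] -/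
theorem a₃_eq_sym (τ : 𝔸 →L[ℂ] ℂ) (U : Λ → 𝔸ˣ) (bd : Fin 4 → Λ × Bool) (A : Λ → 𝔸) :
    a₃ τ U bd A = mainTermSym τ U bd A
      - (2 : ℂ)⁻¹ * (τ (polyC (tw U bd A) * ((plaqWord U bd 0 : 𝔸) - 1))
        + τ (((((plaqWord U bd 0)⁻¹ : 𝔸ˣ) : 𝔸) - 1) * polyC (twR U bd A))) := by
  have key := polyC_four_add_rev_eq (tv U bd A 0) (tv U bd A 1) (tv U bd A 2) (tv U bd A 3)
  have hsum : τ (polyC (tw U bd A)) + τ (polyC (twR U bd A)) =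
      (2 : ℂ)⁻¹ * τ (curl4 (tv U bd A 0) (tv U bd A 1) (tv U bd A 2) (tv U bd A 3)
        * comm4 (tv U bd A 0) (tv U bd A 1) (tv U bd A 2) (tv U bd A 3)
      + comm4 (tv U bd A 0) (tv U bd A 1) (tv U bd A 2) (tv U bd A 3)
        * curl4 (tv U bd A 0) (tv U bd A 1) (tv U bd A 2) (tv U bd A 3)) := by
    rw [← map_add, tw_eq, twR_eq, key, map_smul, smul_eq_mul]
  have e1 : τ (polyC (tw U bd A) * (plaqWord U bd 0 : 𝔸)) =
      τ (polyC (tw U bd A) * ((plaqWord U bd 0 : 𝔸) - 1)) + τ (polyC (tw U bd A)) := by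
    rw [← map_add, mul_sub, mul_one, sub_add_cancel]
  have e2 : τ ((((plaqWord U bd 0)⁻¹ : 𝔸ˣ) : 𝔸) * polyC (twR U bd A)) =
      τ (((((plaqWord U bd 0)⁻¹ : 𝔸ˣ) : 𝔸) - 1) * polyC (twR U bd A)) + τ (polyC (twR U bd A)) := by
    rw [← map_add, sub_mul, one_mul, sub_add_cancel]
  rw [a₃, coef, mainTermSym, e1, e2]
  linear_combination (-(2 : ℂ)⁻¹) * hsum

omit [Fintype Λ] in
/-- Under the trace property the two main terms agree. [folklore] -/
theorem mainTermSym_eq_mainTerm (τ : 𝔸 →L[ℂ] ℂ) (hτ : ∀ X Y : 𝔸, τ (X * Y) = τ (Y * X)) (U : Λ → 𝔸ˣ)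
    (bd : Fin 4 → Λ × Bool) (A : Λ → 𝔸) : mainTermSym τ U bd A = mainTerm τ U bd A := by
  rw [mainTermSym, mainTerm, map_add, hτ (comm4 _ _ _ _)]
  ring

/-- … and so do the two remainders. [folklore] -/
theorem V0remSym_eq_V0rem (τ : 𝔸 →L[ℂ] ℂ) (hτ : ∀ X Y : 𝔸, τ (X * Y) = τ (Y * X)) (U : Λ → 𝔸ˣ)
    (bd : Fin 4 → Λ × Bool) (A : Λ → 𝔸) : V0remSym τ U bd A = V0rem τ U bd A := by
  rw [V0remSym, V0rem, mainTermSym_eq_mainTerm τ hτ]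

end Defs

/-! ## §2 One regularity number -/

omit [NormedAlgebra ℂ 𝔸] [CompleteSpace 𝔸] in
/-- `‖W⁻¹ − 1‖ ≤ ‖W − 1‖` when `‖W⁻¹‖ ≤ 1` (`W⁻¹ − 1 = W⁻¹(1 − W)`). [folklore] -/
theorem norm_inv_sub_one_le {W : 𝔸ˣ} (hW : ‖((W⁻¹ : 𝔸ˣ) : 𝔸)‖ ≤ 1) :
    ‖((W⁻¹ : 𝔸ˣ) : 𝔸) - 1‖ ≤ ‖(W : 𝔸) - 1‖ := by
  have h : ((W⁻¹ : 𝔸ˣ) : 𝔸) - 1 = ((W⁻¹ : 𝔸ˣ) : 𝔸) * (1 - (W : 𝔸)) := by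
    rw [mul_sub, mul_one, Units.inv_mul]
  rw [h]
  calc _ ≤ ‖((W⁻¹ : 𝔸ˣ) : 𝔸)‖ * ‖1 - (W : 𝔸)‖ := norm_mul_le _ _
    _ ≤ 1 * ‖1 - (W : 𝔸)‖ := by gcongr
    _ = ‖(W : 𝔸) - 1‖ := by rw [one_mul, norm_sub_rev]

/-! ## §2b The bounds, for every `τ` -/

section Bounds

variable [Fintype Λ] [NormOneClass 𝔸] {U : Λ → 𝔸ˣ} (hU : ∀ b, ‖(U b : 𝔸)‖ ≤ 1)
  (hU' : ∀ b, ‖(((U b)⁻¹ : 𝔸ˣ) : 𝔸)‖ ≤ 1)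
include hU hU'

/-- **THE (40)-SHAPE BOUND, TRACE-FREE**: for ANY `τ : 𝔸 →L[ℂ] ℂ`, a unit-bounded background with `‖U₀(∂p) − 1‖ ≤ ε₀`, and
twisted amplitude `S ≤ 1`: `‖V0remSym τ U bd A‖ ≤ ‖τ‖·(S³·ε₀∕6 + (5∕96)·S⁴)`. [folklore] -/
theorem norm_V0remSym_le (τ : 𝔸 →L[ℂ] ℂ) (bd : Fin 4 → Λ × Bool) (A : Λ → 𝔸) {ε₀ : ℝ}
    (hε₀ : ‖(plaqWord U bd (0 : Λ → 𝔸) : 𝔸) - 1‖ ≤ ε₀) (hS : amp U bd A ≤ 1) :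
    ‖V0remSym τ U bd A‖ ≤ ‖τ‖ * (amp U bd A ^ 3 / 6 * ε₀ + 5 / 96 * amp U bd A ^ 4) := by
  have hS0 := amp_nonneg (U := U) bd A
  have hε : 0 ≤ ε₀ := (norm_nonneg _).trans hε₀
  have hW' : ‖(((plaqWord U bd (0 : Λ → 𝔸))⁻¹ : 𝔸ˣ) : 𝔸)‖ ≤ 1 := by
    simpa using (ShellMeasureWilsonGradientTail.expWord_plaqWord hU hU' bd).le_inv 0
  have hε₀' : ‖(((plaqWord U bd (0 : Λ → 𝔸))⁻¹ : 𝔸ˣ) : 𝔸) - 1‖ ≤ ε₀ := (norm_inv_sub_one_le hW').trans hε₀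
  have hC : ‖polyC (tw U bd A)‖ ≤ amp U bd A ^ 3 / 6 := (t3_expProd_of_le (ys := tw U bd A) le_rfl).norm_cub
  have hC' : ‖polyC (twR U bd A)‖ ≤ amp U bd A ^ 3 / 6 :=
    (t3_expProd_of_le (ys := twR U bd A) (s := amp U bd A) (by rw [twR, sum_norm_reverse_neg]; rfl)).norm_cub
  have htail : ‖plaqFunSym τ U bd A - cubicPoly τ U bd A 1‖ ≤ ‖τ‖ * (5 / 96 * amp U bd A ^ 4) := by
    have h := norm_slice_sub_cubicPoly_le hU hU' τ bd A 1
    rw [one_smul, norm_one, one_mul] at h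
    exact h.trans (mul_le_mul_of_nonneg_left (expRem4_le hS0 hS) (norm_nonneg _))
  have h1 : ‖τ (polyC (tw U bd A) * ((plaqWord U bd 0 : 𝔸) - 1))‖ ≤ ‖τ‖ * (amp U bd A ^ 3 / 6 * ε₀) := by
    refine (τ.le_opNorm _).trans (mul_le_mul_of_nonneg_left ?_ (norm_nonneg _))
    exact (norm_mul_le _ _).trans (mul_le_mul hC hε₀ (norm_nonneg _) (by positivity))
  have h2 : ‖τ (((((plaqWord U bd 0)⁻¹ : 𝔸ˣ) : 𝔸) - 1) * polyC (twR U bd A))‖ ≤ ‖τ‖ * (amp U bd A ^ 3 / 6 * ε₀) := by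
    refine (τ.le_opNorm _).trans (mul_le_mul_of_nonneg_left ?_ (norm_nonneg _))
    calc _ ≤ ‖(((plaqWord U bd 0)⁻¹ : 𝔸ˣ) : 𝔸) - 1‖ * ‖polyC (twR U bd A)‖ := norm_mul_le _ _
      _ ≤ ε₀ * (amp U bd A ^ 3 / 6) := mul_le_mul hε₀' hC' (norm_nonneg _) hε
      _ = amp U bd A ^ 3 / 6 * ε₀ := mul_comm _ _
  have hsplit : V0remSym τ U bd A =
      -((2 : ℂ)⁻¹ * (τ (polyC (tw U bd A) * ((plaqWord U bd 0 : 𝔸) - 1))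
        + τ (((((plaqWord U bd 0)⁻¹ : 𝔸ˣ) : 𝔸) - 1) * polyC (twR U bd A))))
        + (plaqFunSym τ U bd A - cubicPoly τ U bd A 1) := by
    rw [V0remSym, ord₃_plaqFunSym_eq hU hU', a₃_eq_sym τ]
    ring
  rw [hsplit]
  calc _ ≤ ‖-((2 : ℂ)⁻¹ * (τ (polyC (tw U bd A) * ((plaqWord U bd 0 : 𝔸) - 1))
          + τ (((((plaqWord U bd 0)⁻¹ : 𝔸ˣ) : 𝔸) - 1) * polyC (twR U bd A))))‖
        + ‖plaqFunSym τ U bd A - cubicPoly τ U bd A 1‖ := norm_add_le _ _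
    _ ≤ 2⁻¹ * (‖τ‖ * (amp U bd A ^ 3 / 6 * ε₀) + ‖τ‖ * (amp U bd A ^ 3 / 6 * ε₀)) + ‖τ‖ * (5 / 96 * amp U bd A ^ 4) := by
        refine add_le_add ?_ htail
        rw [norm_neg, norm_mul, norm_inv, RCLike.norm_ofNat]
        gcongr
        exact (norm_add_le _ _).trans (add_le_add h1 h2)
    _ = ‖τ‖ * (amp U bd A ^ 3 / 6 * ε₀ + 5 / 96 * amp U bd A ^ 4) := by ring

/-- … in the field's own size: `‖A(bᵢ)‖ ≤ σ`, `4σ ≤ 1` ⟹ `‖V0remSym‖ ≤ ‖τ‖·((32∕3)ε₀σ³ + (40∕3)σ⁴)`. [folklore] -/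
theorem norm_V0remSym_le_of_bonds (τ : 𝔸 →L[ℂ] ℂ) (bd : Fin 4 → Λ × Bool) {A : Λ → 𝔸} {ε₀ σ : ℝ}
    (hε₀ : ‖(plaqWord U bd (0 : Λ → 𝔸) : 𝔸) - 1‖ ≤ ε₀) (hA : ∀ i, ‖A (bd i).1‖ ≤ σ) (hσ : 4 * σ ≤ 1) :
    ‖V0remSym τ U bd A‖ ≤ ‖τ‖ * (32 / 3 * ε₀ * σ ^ 3 + 40 / 3 * σ ^ 4) := by
  have hS0 := amp_nonneg (U := U) bd A
  have hS4 : amp U bd A ≤ 4 * σ := amp_le_four_mul hU hU' bd hA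
  have hε : 0 ≤ ε₀ := (norm_nonneg _).trans hε₀
  have h := norm_V0remSym_le hU hU' τ bd A hε₀ (hS4.trans hσ)
  refine h.trans (mul_le_mul_of_nonneg_left ?_ (norm_nonneg _))
  have h3 : amp U bd A ^ 3 ≤ (4 * σ) ^ 3 := by gcongr
  have h4 : amp U bd A ^ 4 ≤ (4 * σ) ^ 4 := by gcongr
  nlinarith

omit [NormedAlgebra ℂ 𝔸] [CompleteSpace 𝔸] [Fintype Λ] [NormOneClass 𝔸] hU hU' in
/-- The letters' bonds lie in `bonds bd`. [folklore] -/
theorem fst_mem_bonds [DecidableEq Λ] (bd : Fin 4 → Λ × Bool) (i : Fin 4) : (bd i).1 ∈ bonds bd :=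
  Finset.mem_image.2 ⟨i, Finset.mem_univ _, rfl⟩

/-- **THE CUBIC BINDER IN ROW S65 f2b's `hcub` SHAPE (one grid, `W p = 1`)**: for a unit-bounded background with
`‖U₀(∂p) − 1‖ ≤ ε₀` and a size cap `4s₀ ≤ 1`, for EVERY `τ`:
`∀ A σ, 0 ≤ σ → σ < s₀ → (∀ b′ ∈ bonds bd, ‖A b′‖ ≤ σ) → ‖V0remSym τ U bd A‖ ≤ ‖τ‖·(32∕3·ε₀ + 40∕3·s₀)·σ³` — the `κ` of
`weighted_locGrad_le`∕`prop4Hyp_locGrad_levels` is `‖τ‖·(32∕3·ε₀ + 40∕3·s₀)`, SMALL with the background's plaquette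
regularity `ε₀` and the field cap `s₀`. [folklore] -/
theorem hcub_V0remSym [DecidableEq Λ] (τ : 𝔸 →L[ℂ] ℂ) (bd : Fin 4 → Λ × Bool) {ε₀ s₀ : ℝ}
    (hε₀ : ‖(plaqWord U bd (0 : Λ → 𝔸) : 𝔸) - 1‖ ≤ ε₀) (hs₀ : 4 * s₀ ≤ 1) :
    ∀ (A : Λ → 𝔸) (σ : ℝ), 0 ≤ σ → σ < s₀ → (∀ b' ∈ bonds bd, ‖A b'‖ ≤ σ) →
      ‖V0remSym τ U bd A‖ ≤ ‖τ‖ * (32 / 3 * ε₀ + 40 / 3 * s₀) * σ ^ 3 := by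
  intro A σ hσ0 hσ hA
  have hε : 0 ≤ ε₀ := (norm_nonneg _).trans hε₀
  have hA' : ∀ i, ‖A (bd i).1‖ ≤ σ := fun i => hA _ (fst_mem_bonds bd i)
  have h := norm_V0remSym_le_of_bonds hU hU' τ bd hε₀ hA' (by linarith)
  refine h.trans ?_
  have hτ0 : 0 ≤ ‖τ‖ := norm_nonneg _
  have h4 : σ ^ 4 ≤ s₀ * σ ^ 3 := by nlinarith [pow_nonneg hσ0 3]
  nlinarith [pow_nonneg hσ0 3, mul_nonneg hτ0 (pow_nonneg hσ0 3)]

end Bounds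

/-! ## §3 Locality: `V₀′` does not see bonds off `∂p` -/

section Local

variable [DecidableEq Λ]

omit [CompleteSpace 𝔸] in
/-- A twisted variable reads the field on its own bond only. [folklore] -/
theorem twistVar_add_single (U : Λ → 𝔸ˣ) (h : 𝔸ˣ) (bσ : Λ × Bool) (A : Λ → 𝔸) {b : Λ} (hb : bσ.1 ≠ b) (X : 𝔸) :
    twistVar U h bσ (A + Pi.single b X) = twistVar U h bσ A := by
  unfold twistVar
  simp only [Pi.add_apply, Pi.single_eq_of_ne hb, add_zero]

/-- The plaquette word reads the field on `∂p` only. [folklore] -/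
theorem plaqWord_add_single (U : Λ → 𝔸ˣ) (bd : Fin 4 → Λ × Bool) (A : Λ → 𝔸) {b : Λ} (hb : b ∉ bonds bd) (X : 𝔸) :
    plaqWord U bd (A + Pi.single b X) = plaqWord U bd A := by
  have hne : ∀ i, (bd i).1 ≠ b := fun i h => hb (Finset.mem_image.2 ⟨i, Finset.mem_univ _, h⟩)
  have hl : ∀ bσ ∈ List.ofFn bd, letter U (A + Pi.single b X) bσ = letter U A bσ := by
    intro bσ hbσ
    obtain ⟨i, rfl⟩ := List.mem_ofFn.1 hbσ
    simp only [letter, Pi.add_apply, Pi.single_eq_of_ne (hne i), add_zero]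
  unfold plaqWord
  rw [List.map_congr_left hl]

/-- The four twisted variables read the field on `∂p` only. [folklore] -/
theorem tv_add_single (U : Λ → 𝔸ˣ) (bd : Fin 4 → Λ × Bool) (A : Λ → 𝔸) {b : Λ} (hb : b ∉ bonds bd) (X : 𝔸)
    (i : Fin 4) : tv U bd (A + Pi.single b X) i = tv U bd A i := by
  have hne : (bd i).1 ≠ b := fun h => hb (Finset.mem_image.2 ⟨i, Finset.mem_univ _, h⟩)
  exact twistVar_add_single U (pre U bd i) (bd i) A hne X

/-- … hence so do `tw`, `twR`. [folklore] -/
theorem tw_add_single (U : Λ → 𝔸ˣ) (bd : Fin 4 → Λ × Bool) (A : Λ → 𝔸) {b : Λ} (hb : b ∉ bonds bd) (X : 𝔸) :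
    tw U bd (A + Pi.single b X) = tw U bd A ∧ twR U bd (A + Pi.single b X) = twR U bd A := by
  have h : tw U bd (A + Pi.single b X) = tw U bd A := by
    rw [tw_eq, tw_eq, tv_add_single U bd A hb, tv_add_single U bd A hb, tv_add_single U bd A hb, tv_add_single U bd A hb]
  exact ⟨h, by rw [twR, twR, h]⟩

/-- … and the cubic Taylor polynomial of the slice. [folklore] -/
theorem cubicPoly_add_single (τ : 𝔸 →L[ℂ] ℂ) (U : Λ → 𝔸ˣ) (bd : Fin 4 → Λ × Bool) (A : Λ → 𝔸) {b : Λ}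
    (hb : b ∉ bonds bd) (X : 𝔸) (t : ℂ) :
    cubicPoly τ U bd (A + Pi.single b X) t = cubicPoly τ U bd A t ∧ a₃ τ U bd (A + Pi.single b X) = a₃ τ U bd A := by
  obtain ⟨h1, h2⟩ := tw_add_single U bd A hb X
  refine ⟨?_, ?_⟩
  · simp only [cubicPoly, a₁, a₂, a₃, h1, h2]
  · simp only [a₃, h1, h2]

variable [Fintype Λ]

/-- **LOCALITY OF `ord₃` OF THE SYMMETRISED PLAQUETTE FUNCTIONAL.** [folklore] -/
theorem ord₃_plaqFunSym_add_single [NormOneClass 𝔸] {U : Λ → 𝔸ˣ} (hU : ∀ b, ‖(U b : 𝔸)‖ ≤ 1)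
    (hU' : ∀ b, ‖(((U b)⁻¹ : 𝔸ˣ) : 𝔸)‖ ≤ 1) (τ : 𝔸 →L[ℂ] ℂ) (bd : Fin 4 → Λ × Bool) (A : Λ → 𝔸) {b : Λ}
    (hb : b ∉ bonds bd) (X : 𝔸) :
    ord₃ (plaqFunSym τ U bd) (A + Pi.single b X) = ord₃ (plaqFunSym τ U bd) A := by
  obtain ⟨hP, ha⟩ := cubicPoly_add_single τ U bd A hb X 1
  rw [ord₃_plaqFunSym_eq hU hU', ord₃_plaqFunSym_eq hU hU', hP, ha, plaqFunSym, plaqFunSym, plaqWord_add_single U bd A hb]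

/-- **LOCALITY OF `V₀′`** (row S65 f2b's `hloc` shape): `V0remSym τ U bd (A + Pi.single b X) = V0remSym τ U bd A` for
`b ∉ bonds bd`. [folklore] -/
theorem V0remSym_add_single [NormOneClass 𝔸] {U : Λ → 𝔸ˣ} (hU : ∀ b, ‖(U b : 𝔸)‖ ≤ 1)
    (hU' : ∀ b, ‖(((U b)⁻¹ : 𝔸ˣ) : 𝔸)‖ ≤ 1) (τ : 𝔸 →L[ℂ] ℂ) (bd : Fin 4 → Λ × Bool) (A : Λ → 𝔸) {b : Λ}
    (hb : b ∉ bonds bd) (X : 𝔸) :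
    V0remSym τ U bd (A + Pi.single b X) = V0remSym τ U bd A := by
  rw [V0remSym, V0remSym, ord₃_plaqFunSym_add_single hU hU' τ bd A hb, mainTermSym, mainTermSym,
    tv_add_single U bd A hb, tv_add_single U bd A hb, tv_add_single U bd A hb, tv_add_single U bd A hb]

/-- … and of file 5's `V0rem`. [folklore] -/
theorem V0rem_add_single [NormOneClass 𝔸] {U : Λ → 𝔸ˣ} (hU : ∀ b, ‖(U b : 𝔸)‖ ≤ 1)
    (hU' : ∀ b, ‖(((U b)⁻¹ : 𝔸ˣ) : 𝔸)‖ ≤ 1) (τ : 𝔸 →L[ℂ] ℂ) (bd : Fin 4 → Λ × Bool) (A : Λ → 𝔸) {b : Λ}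
    (hb : b ∉ bonds bd) (X : 𝔸) :
    V0rem τ U bd (A + Pi.single b X) = V0rem τ U bd A := by
  rw [V0rem, V0rem, ord₃_plaqFunSym_add_single hU hU' τ bd A hb, mainTerm, mainTerm,
    tv_add_single U bd A hb, tv_add_single U bd A hb, tv_add_single U bd A hb, tv_add_single U bd A hb]

end Local

/-! ## §4 Analyticity of `V₀′` -/

section Analytic

/-- `ord₃ V` is analytic wherever `V` is (the 2-jet is a continuous polynomial). [folklore] -/
theorem analyticAt_ord₃ {E : Type*} [NormedAddCommGroup E] [NormedSpace ℂ E] {V : E → ℂ} {A : E}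
    (hV : AnalyticAt ℂ V A) : AnalyticAt ℂ (ord₃ V) A := by
  have e : ord₃ V = fun A => V A - (V 0 + fderiv ℂ V 0 A + (2 : ℂ)⁻¹ * fderiv ℂ (fderiv ℂ V) 0 A A) := by
    funext A
    rfl
  rw [e]
  have hq : AnalyticAt ℂ (fun x : E => fderiv ℂ (fderiv ℂ V) 0 x x) A :=
    ((fderiv ℂ (fderiv ℂ V) 0).analyticAt_bilinear (A, A)).comp₂ analyticAt_id analyticAt_id
  exact hV.fun_sub ((analyticAt_const.fun_add ((fderiv ℂ V 0).analyticAt A)).fun_add (analyticAt_const.fun_mul hq))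

variable [Fintype Λ]

/-- Each twisted variable is analytic (indeed linear) in the field. [folklore] -/
theorem analyticAt_tv (U : Λ → 𝔸ˣ) (bd : Fin 4 → Λ × Bool) (i : Fin 4) (A₀ : Λ → 𝔸) :
    AnalyticAt ℂ (fun A : Λ → 𝔸 => tv U bd A i) A₀ := by
  have hb : AnalyticAt ℂ (fun A : Λ → 𝔸 => A (bd i).1) A₀ :=
    (ContinuousLinearMap.proj (R := ℂ) (φ := fun _ : Λ => 𝔸) (bd i).1).analyticAt A₀
  unfold tv twistVar
  split_ifs
  · simp only [conjR_apply]
    exact (analyticAt_const.fun_mul hb.fun_const_smul).fun_mul analyticAt_const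
  · simp only [conjR_apply]
    exact (analyticAt_const.fun_mul hb.fun_const_smul).fun_mul analyticAt_const

/-- The trace-free main term is analytic in the field. [folklore] -/
theorem analyticAt_mainTermSym (τ : 𝔸 →L[ℂ] ℂ) (U : Λ → 𝔸ˣ) (bd : Fin 4 → Λ × Bool) (A₀ : Λ → 𝔸) :
    AnalyticAt ℂ (mainTermSym τ U bd) A₀ := by
  have h0 := analyticAt_tv U bd 0 A₀
  have h1 := analyticAt_tv U bd 1 A₀
  have h2 := analyticAt_tv U bd 2 A₀
  have h3 := analyticAt_tv U bd 3 A₀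
  have hY : AnalyticAt ℂ (fun A => curl4 (tv U bd A 0) (tv U bd A 1) (tv U bd A 2) (tv U bd A 3)) A₀ := by
    unfold curl4
    exact ((h0.fun_add h1).fun_add h2).fun_add h3
  have hK : AnalyticAt ℂ (fun A => comm4 (tv U bd A 0) (tv U bd A 1) (tv U bd A 2) (tv U bd A 3)) A₀ := by
    unfold comm4
    exact ((((((h0.fun_mul h1).fun_sub (h1.fun_mul h0)).fun_add ((h0.fun_mul h2).fun_sub (h2.fun_mul h0))).fun_add
      ((h0.fun_mul h3).fun_sub (h3.fun_mul h0))).fun_add ((h1.fun_mul h2).fun_sub (h2.fun_mul h1))).fun_add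
      ((h1.fun_mul h3).fun_sub (h3.fun_mul h1))).fun_add ((h2.fun_mul h3).fun_sub (h3.fun_mul h2))
  have hin : AnalyticAt ℂ (fun A => τ (curl4 (tv U bd A 0) (tv U bd A 1) (tv U bd A 2) (tv U bd A 3)
      * comm4 (tv U bd A 0) (tv U bd A 1) (tv U bd A 2) (tv U bd A 3)
      + comm4 (tv U bd A 0) (tv U bd A 1) (tv U bd A 2) (tv U bd A 3)
      * curl4 (tv U bd A 0) (tv U bd A 1) (tv U bd A 2) (tv U bd A 3))) A₀ :=
    (τ.analyticAt _).comp ((hY.fun_mul hK).fun_add (hK.fun_mul hY))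
  exact (analyticAt_const.fun_mul hin).fun_neg

/-- **`V₀′` IS ANALYTIC EVERYWHERE** (row S65 f2a's `ha` ∕ f2b's `hd`). [folklore] -/
theorem analyticAt_V0remSym [NormOneClass 𝔸] {U : Λ → 𝔸ˣ} (hU : ∀ b, ‖(U b : 𝔸)‖ ≤ 1)
    (hU' : ∀ b, ‖(((U b)⁻¹ : 𝔸ˣ) : 𝔸)‖ ≤ 1) (τ : 𝔸 →L[ℂ] ℂ) (bd : Fin 4 → Λ × Bool) (A₀ : Λ → 𝔸) :
    AnalyticAt ℂ (V0remSym τ U bd) A₀ :=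
  (analyticAt_ord₃ (analyticAt_plaqFunSym hU hU' τ bd A₀)).fun_sub (analyticAt_mainTermSym τ U bd A₀)

/-- … hence on every set. [folklore] -/
theorem analyticOnNhd_V0remSym [NormOneClass 𝔸] {U : Λ → 𝔸ˣ} (hU : ∀ b, ‖(U b : 𝔸)‖ ≤ 1)
    (hU' : ∀ b, ‖(((U b)⁻¹ : 𝔸ˣ) : 𝔸)‖ ≤ 1) (τ : 𝔸 →L[ℂ] ℂ) (bd : Fin 4 → Λ × Bool) (s : Set (Λ → 𝔸)) :
    AnalyticOnNhd ℂ (V0remSym τ U bd) s := fun A _ => analyticAt_V0remSym hU hU' τ bd A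

end Analytic

end Summit.QuantumFields.BalabanUV.T4Continuum.ShellMeasurePlaquetteCubicLocal

end
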